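import Summits.CriticalPhenomena.PercolationContinuityZ3.Theorems.PercNearOneGluingNoHeavyQuantFarGate3BoxCertK
import Summits.CriticalPhenomena.PercolationContinuityZ3.Theorems.PercNearOneGluingNoHeavyQuantFarGate3BoxCertU
import HarnessLib

/-!
# QUANT lane R8, front "FAR beyond trees", layer one — THE DEGREE-THREE GATE AT THE OBSERVER, XLIVc: box-certificate kernel IIIc — the assembled polynomial evaluates to `D · condU`

builds on p205010 (kernel theorem, internal audit signed; external expert review pending)

Support file (`--supports stmt-CriticalPhenomena-4575`), seat `prim-quant-p1` (gen 31); memo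
`run/shared/lean/prim/quant/prim-quant-p1-g31/FOR-LEAD-GATE3-BOXES.md`.  Mathlib-only + earlier files of the box-certificate kernel; standard axioms;
no sorries.  GENERATED by `work/lean/gen_boxcert.py` (one generator, four files XLIVa–d).

Real multipliers read off the data (`mval`, `lamL`, `nuL`) and the key identity `eval_polyOf`: the integer polynomial assembled by `check` evaluates at
`(p, 1 − r₁, 1 − r₂)` to `D · condU` of those multipliers (entrywise: `eval_monoMul`, `eval_cellTable`, `eval_contrib`, `condU_single`).
[this work].
-/

namespace Summit.CriticalPhenomena.PercolationContinuityZ3.Theorems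

namespace Quant

namespace BoxCert

open BoxPoly

/-! ## Real multipliers defined by the data -/

/-- Value of the monomial `p^a w₁^b w₂^c`, `m = a + 2b + 4c`. -/
noncomputable def mval (m : ℕ) (p w₁ w₂ : ℝ) : ℝ :=
  (if m % 2 = 1 then p else 1) * ((if m % 4 / 2 = 1 then w₁ else 1) * (if m % 8 / 4 = 1 then w₂ else 1))

/-- Extra factor `p` carried by the `g_S` and `E` multipliers. -/
noncomputable def sfac (kind : ℕ) (p : ℝ) : ℝ := if kind = 3 ∨ kind = 4 then p else 1

/-- Weight of entry `e` at `(p, r₁, r₂)`. -/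
noncomputable def wt (e : Entry) (p r₁ r₂ : ℝ) : ℝ := (e.mu : ℝ) * mval e.mono p (1 - r₁) (1 - r₂) * sfac e.kind p

/-- The linear multipliers `lam i c` defined by a list of entries. -/
noncomputable def lamL (L : List Entry) (p r₁ r₂ : ℝ) (i : Fin 5) (c : Fin 8) : ℝ :=
  (L.map fun e => if e.kind = i.val ∧ e.idx = c.val then wt e p r₁ r₂ else 0).sum

/-- The Harris multipliers `nu k` defined by a list of entries. -/
noncomputable def nuL (L : List Entry) (p r₁ r₂ : ℝ) (k : Fin 6) : ℝ :=
  (L.map fun e => if e.kind = 5 ∧ e.idx = k.val then wt e p r₁ r₂ else 0).sum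

/-- `Gco` indexed by a natural number (0 outside `0..4`). -/
noncomputable def GcoN (p r₁ r₂ nS nE : ℝ) (kind : ℕ) (c : Fin 8) : ℝ :=
  if kind = 0 then Gco p r₁ r₂ nS nE 0 c else if kind = 1 then Gco p r₁ r₂ nS nE 1 c else if kind = 2 then Gco p r₁ r₂ nS nE 2 c
  else if kind = 3 then Gco p r₁ r₂ nS nE 3 c else if kind = 4 then Gco p r₁ r₂ nS nE 4 c else 0

/-- `Hrow` indexed by a natural number (0 outside `0..5`). -/
def HrowN (k : ℕ) (c c' : Fin 8) : ℤ :=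
  if k = 0 then Hrow 0 c c' else if k = 1 then Hrow 1 c c' else if k = 2 then Hrow 2 c c' else if k = 3 then Hrow 3 c c'
  else if k = 4 then Hrow 4 c c' else if k = 5 then Hrow 5 c c' else 0

/-- Real contribution of one entry to `D · condU`. -/
noncomputable def condE (d : Cert) (e : Entry) (p r₁ r₂ nS nE : ℝ) (c c' : Fin 8) : ℝ :=
  if e.kind ≤ 4 then
    (if e.idx = c.val then (d.D : ℝ) * wt e p r₁ r₂ * GcoN p r₁ r₂ nS nE e.kind c' else 0) +
      (if e.idx = c'.val ∧ c ≠ c' then (d.D : ℝ) * wt e p r₁ r₂ * GcoN p r₁ r₂ nS nE e.kind c else 0)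
  else if e.kind = 5 then (d.D : ℝ) * wt e p r₁ r₂ * (HrowN e.idx c c' : ℝ)
  else 0

/-- Monomial values are non-negative on the box. [this work] -/
theorem mval_nonneg (m : ℕ) (p w₁ w₂ : ℝ) (hp : 0 ≤ p) (h1 : 0 ≤ w₁) (h2 : 0 ≤ w₂) : 0 ≤ mval m p w₁ w₂ := by
  unfold mval; split_ifs <;> positivity

/-- Monomial values are positive in the open box. [this work] -/
theorem mval_pos (m : ℕ) (p w₁ w₂ : ℝ) (hp : 0 < p) (h1 : 0 < w₁) (h2 : 0 < w₂) : 0 < mval m p w₁ w₂ := by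
  unfold mval; split_ifs <;> positivity

/-- Entry weights are non-negative. [this work] -/
theorem wt_nonneg (e : Entry) (p r₁ r₂ : ℝ) (hp : 0 ≤ p) (h1 : r₁ ≤ 1) (h2 : r₂ ≤ 1) : 0 ≤ wt e p r₁ r₂ := by
  unfold wt sfac
  have := mval_nonneg e.mono p (1 - r₁) (1 - r₂) hp (by linarith) (by linarith)
  split_ifs <;> positivity

/-- The linear multipliers are non-negative. [this work] -/
theorem lamL_nonneg (L : List Entry) (p r₁ r₂ : ℝ) (hp : 0 ≤ p) (h1 : r₁ ≤ 1) (h2 : r₂ ≤ 1) (i : Fin 5) (c : Fin 8) :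
    0 ≤ lamL L p r₁ r₂ i c := by
  unfold lamL
  apply List.sum_nonneg
  intro x hx
  rw [List.mem_map] at hx
  obtain ⟨e, -, rfl⟩ := hx
  split_ifs
  · exact wt_nonneg e p r₁ r₂ hp h1 h2
  · exact le_rfl

/-- The Harris multipliers are non-negative. [this work] -/
theorem nuL_nonneg (L : List Entry) (p r₁ r₂ : ℝ) (hp : 0 ≤ p) (h1 : r₁ ≤ 1) (h2 : r₂ ≤ 1) (k : Fin 6) : 0 ≤ nuL L p r₁ r₂ k := by
  unfold nuL
  apply List.sum_nonneg
  intro x hx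
  rw [List.mem_map] at hx
  obtain ⟨e, -, rfl⟩ := hx
  split_ifs
  · exact wt_nonneg e p r₁ r₂ hp h1 h2
  · exact le_rfl

/-! ## The key identity: the assembled integer polynomial evaluates to `D · condU` -/

/-- `shiftX_topY` (see the file docstring). [this work] -/
theorem shiftX_topY (q : P2 ℤ) (h : ∀ i k : Fin 3, q i 2 k = 0) : ∀ i k : Fin 3, shiftX q i 2 k = 0 := by
  intro i k; fin_cases i <;> simp [shiftX, h]
/-- `shiftX_topZ` (see the file docstring). [this work] -/
theorem shiftX_topZ (q : P2 ℤ) (h : ∀ i j : Fin 3, q i j 2 = 0) : ∀ i j : Fin 3, shiftX q i j 2 = 0 := by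
  intro i j; fin_cases i <;> simp [shiftX, h]
/-- `PS1` (the `nn`-coefficients of `g_S`) is linear in `p`: empty top x-slice. -/
theorem PS1_topX' (c : Fin 8) : ∀ j k : Fin 3, PS1 c 2 j k = 0 := by revert c; decide
/-- `PE1` (the `nn`-coefficients of `E`) is linear in `p`: empty top x-slice. -/
theorem PE1_topX' (c : Fin 8) : ∀ j k : Fin 3, PE1 c 2 j k = 0 := by revert c; decide
/-- A z-shift keeps the top y-slice empty. [this work] -/
theorem shiftZ_topY (q : P2 ℤ) (h : ∀ i k : Fin 3, q i 2 k = 0) : ∀ i k : Fin 3, shiftZ q i 2 k = 0 := by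
  intro i k; fin_cases k <;> simp [shiftZ, h]
/-- A z-shift keeps the top x-slice empty. [this work] -/
theorem shiftZ_topX (q : P2 ℤ) (h : ∀ j k : Fin 3, q 2 j k = 0) : ∀ j k : Fin 3, shiftZ q 2 j k = 0 := by
  intro j k; fin_cases k <;> simp [shiftZ, h]
/-- A y-shift keeps the top x-slice empty. [this work] -/
theorem shiftY_topX (q : P2 ℤ) (h : ∀ j k : Fin 3, q 2 j k = 0) : ∀ j k : Fin 3, shiftY q 2 j k = 0 := by
  intro j k; fin_cases j <;> simp [shiftY, h]

/-- `monoMul` is multiplication by the monomial (given no overflow). -/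
theorem eval_monoMul (m : ℕ) (q : P2 ℤ) (x y z : ℝ)
    (hX : m % 2 = 1 → ∀ j k : Fin 3, q 2 j k = 0) (hY : ∀ i k : Fin 3, q i 2 k = 0) (hZ : ∀ i j : Fin 3, q i j 2 = 0) :
    eval (map (Int.castRingHom ℝ) (monoMul m q)) x y z = mval m x y z * eval (map (Int.castRingHom ℝ) q) x y z := by
  unfold monoMul mval
  by_cases hz : m % 8 / 4 = 1 <;> by_cases hy : m % 4 / 2 = 1 <;> by_cases hx : m % 2 = 1 <;>
    simp only [hz, hy, hx, if_true, if_false]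
  -- eight cases; each a chain of shift lemmas
  · rw [map_shiftX, eval_shiftX _ (fitsX_map _ _ (shiftY_topX _ (shiftZ_topX q (hX hx)))), map_shiftY,
      eval_shiftY _ (fitsY_map _ _ (shiftZ_topY q hY)), map_shiftZ, eval_shiftZ _ (fitsZ_map _ q hZ)]; ring
  · rw [map_shiftY, eval_shiftY _ (fitsY_map _ _ (shiftZ_topY q hY)), map_shiftZ, eval_shiftZ _ (fitsZ_map _ q hZ)]; ring
  · rw [map_shiftX, eval_shiftX _ (fitsX_map _ _ (shiftZ_topX q (hX hx))), map_shiftZ, eval_shiftZ _ (fitsZ_map _ q hZ)]; ring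
  · rw [map_shiftZ, eval_shiftZ _ (fitsZ_map _ q hZ)]; ring
  · rw [map_shiftX, eval_shiftX _ (fitsX_map _ _ (shiftY_topX _ (hX hx))), map_shiftY, eval_shiftY _ (fitsY_map _ _ hY)]; ring
  · rw [map_shiftY, eval_shiftY _ (fitsY_map _ _ hY)]; ring
  · rw [map_shiftX, eval_shiftX _ (fitsX_map _ _ (hX hx))]; ring
  · ring

/-- `smul` keeps the top x-slice empty. [this work] -/
theorem top_smul_X (a : ℤ) (q : P2 ℤ) (h : ∀ j k : Fin 3, q 2 j k = 0) : ∀ j k : Fin 3, smul a q 2 j k = 0 := by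
  intro j k; simp [smul, h j k]
/-- `smul` keeps the top y-slice empty. [this work] -/
theorem top_smul_Y (a : ℤ) (q : P2 ℤ) (h : ∀ i k : Fin 3, q i 2 k = 0) : ∀ i k : Fin 3, smul a q i 2 k = 0 := by
  intro i k; simp [smul, h i k]
/-- `smul` keeps the top z-slice empty. [this work] -/
theorem top_smul_Z (a : ℤ) (q : P2 ℤ) (h : ∀ i j : Fin 3, q i j 2 = 0) : ∀ i j : Fin 3, smul a q i j 2 = 0 := by
  intro i j; simp [smul, h i j]
/-- `add` keeps the top y-slice empty. [this work] -/
theorem top_add_Y (q q' : P2 ℤ) (h : ∀ i k : Fin 3, q i 2 k = 0) (h' : ∀ i k : Fin 3, q' i 2 k = 0) : ∀ i k : Fin 3, add q q' i 2 k = 0 := by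
  intro i k; simp [add, h i k, h' i k]
/-- `add` keeps the top z-slice empty. [this work] -/
theorem top_add_Z (q q' : P2 ℤ) (h : ∀ i j : Fin 3, q i j 2 = 0) (h' : ∀ i j : Fin 3, q' i j 2 = 0) : ∀ i j : Fin 3, add q q' i j 2 = 0 := by
  intro i j; simp [add, h i j, h' i j]

/-- The constant `1` has empty top x-slice. [this work] -/
theorem pone_topX : ∀ j k : Fin 3, pone 2 j k = 0 := by decide
/-- The constant `1` has empty top y-slice. [this work] -/
theorem pone_topY : ∀ i k : Fin 3, pone i 2 k = 0 := by decide
/-- The constant `1` has empty top z-slice. [this work] -/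
theorem pone_topZ : ∀ i j : Fin 3, pone i j 2 = 0 := by decide

/-- The constant `1` evaluates to `1`. [this work] -/
theorem eval_pone (x y z : ℝ) : eval (map (Int.castRingHom ℝ) pone) x y z = 1 := by
  simp [eval, map, pone]

/-- Numeric consequences of `entryOk`. -/
theorem entry_facts (d : Cert) (e : Entry) (he : entryOk d e = true) :
    e.mono < 8 ∧ e.kind ≤ 5 ∧ (e.kind ≤ 4 → e.idx < 8) ∧ (3 ≤ e.kind → e.kind ≤ 4 → e.mono % 2 = 0) ∧ (e.kind = 5 → e.idx < 6) ∧
      (d.sfree = true → e.kind ≠ 3) ∧ (d.efree = true → e.kind ≠ 4) := by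
  simp only [entryOk, Bool.and_eq_true, Bool.or_eq_true, decide_eq_true_eq] at he
  obtain ⟨⟨⟨hmono, hkind⟩, hsf⟩, hef⟩ := he
  refine ⟨hmono, ?_, ?_, ?_, ?_, hsf, hef⟩
  · cases hkind with
    | inl h => cases h with
      | inl h => omega
      | inr h => omega
    | inr h => omega
  · intro h4
    cases hkind with
    | inl h => cases h with
      | inl h => exact h.2
      | inr h => exact h.2.1
    | inr h => omega
  · intro h3 h4
    cases hkind with
    | inl h => cases h with
      | inl h => omega
      | inr h => exact h.2.2
    | inr h => omega
  · intro h5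
    cases hkind with
    | inl h => cases h with
      | inl h => omega
      | inr h => omega
    | inr h => exact h.2

/-- Evaluation of the cell tables (times `D`): the real coefficient `D · sfac · Gco`. -/
theorem eval_cellTable (d : Cert) (kind : ℕ) (hk : kind ≤ 4) (c : Fin 8) (p r₁ r₂ nS nE : ℝ) (hr : r₁ ≤ r₂)
    (hS : kind = 3 → nS * ((d.D : ℝ) * p) = d.SS + d.SS1 * p) (hE : kind = 4 → nE * ((d.D : ℝ) * p) = d.SE + d.SE1 * p) :
    eval (map (Int.castRingHom ℝ) (cellTable d kind c)) p (1 - r₁) (1 - r₂) =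
      (d.D : ℝ) * sfac kind p * GcoN p r₁ r₂ nS nE kind c := by
  interval_cases kind
  · rw [show cellTable d 0 c = smul (d.D : ℤ) (TG 0 c) from rfl, BoxPoly.map_smul, eval_smul, eval_TG]
    simp [sfac, GcoN, Gco]
  · rw [show cellTable d 1 c = smul (d.D : ℤ) (TG 1 c) from rfl, BoxPoly.map_smul, eval_smul, eval_TG]
    simp [sfac, GcoN, Gco]
  · rw [show cellTable d 2 c = smul (d.D : ℤ) (TG 2 c) from rfl, BoxPoly.map_smul, eval_smul, eval_TG]
    simp [sfac, GcoN, Gco]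
  · have h3 := hS rfl
    rw [show cellTable d 3 c = add (add (smul (d.D : ℤ) (PS0 c)) (smul (d.SS : ℤ) (PS1 c))) (smul (d.SS1 : ℤ) (shiftX (PS1 c))) from rfl,
      BoxPoly.map_add, BoxPoly.map_add, eval_add, eval_add, BoxPoly.map_smul, BoxPoly.map_smul, BoxPoly.map_smul, eval_smul, eval_smul, eval_smul,
      BoxPoly.map_shiftX, eval_shiftX _ (fitsX_map _ _ (PS1_topX' c)), eval_PS1 c p r₁ r₂ hr, eval_PS0 c p r₁ r₂ hr]
    simp only [eq_intCast, Int.cast_natCast, sfac, GcoN, Gco]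
    norm_num
    have e3 : nS * GSB p r₁ r₂ c * ((d.D : ℝ) * p) = ((d.SS : ℝ) + d.SS1 * p) * GSB p r₁ r₂ c := by rw [← h3]; ring
    have key : (d.D : ℝ) * p * (nS * GSB p r₁ r₂ c) = ((d.SS : ℝ) + d.SS1 * p) * GSB p r₁ r₂ c := by rw [← e3]; ring
    linear_combination -key
  · have h4 := hE rfl
    rw [show cellTable d 4 c = add (add (smul (d.D : ℤ) (PE0 c)) (smul (d.SE : ℤ) (PE1 c))) (smul (d.SE1 : ℤ) (shiftX (PE1 c))) from rfl,
      BoxPoly.map_add, BoxPoly.map_add, eval_add, eval_add, BoxPoly.map_smul, BoxPoly.map_smul, BoxPoly.map_smul, eval_smul, eval_smul, eval_smul,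
      BoxPoly.map_shiftX, eval_shiftX _ (fitsX_map _ _ (PE1_topX' c)), eval_PE1 c p r₁ r₂ hr, eval_PE0 c p r₁ r₂ hr]
    simp only [eq_intCast, Int.cast_natCast, sfac, GcoN, Gco]
    norm_num
    have e4 : nE * GEB p r₁ r₂ c * ((d.D : ℝ) * p) = ((d.SE : ℝ) + d.SE1 * p) * GEB p r₁ r₂ c := by rw [← h4]; ring
    have key : (d.D : ℝ) * p * (nE * GEB p r₁ r₂ c) = ((d.SE : ℝ) + d.SE1 * p) * GEB p r₁ r₂ c := by rw [← e4]; ring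
    linear_combination -key

/-- Cell tables have empty top y-slice. [this work] -/
theorem cellTable_topY (d : Cert) (kind : ℕ) (c : Fin 8) : ∀ i k : Fin 3, cellTable d kind c i 2 k = 0 := by
  intro i k
  unfold cellTable
  split
  · exact top_smul_Y _ _ (TG_topY 0 c) i k
  · exact top_smul_Y _ _ (TG_topY 1 c) i k
  · exact top_smul_Y _ _ (TG_topY 2 c) i k
  · exact top_add_Y _ _ (top_add_Y _ _ (top_smul_Y _ _ (PS0_topY c)) (top_smul_Y _ _ (PS1_topY c))) (top_smul_Y _ _ (shiftX_topY _ (PS1_topY c))) i k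
  · exact top_add_Y _ _ (top_add_Y _ _ (top_smul_Y _ _ (PE0_topY c)) (top_smul_Y _ _ (PE1_topY c))) (top_smul_Y _ _ (shiftX_topY _ (PE1_topY c))) i k
  · rfl

/-- Cell tables have empty top z-slice. [this work] -/
theorem cellTable_topZ (d : Cert) (kind : ℕ) (c : Fin 8) : ∀ i j : Fin 3, cellTable d kind c i j 2 = 0 := by
  intro i j
  unfold cellTable
  split
  · exact top_smul_Z _ _ (TG_topZ 0 c) i j
  · exact top_smul_Z _ _ (TG_topZ 1 c) i j
  · exact top_smul_Z _ _ (TG_topZ 2 c) i j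
  · exact top_add_Z _ _ (top_add_Z _ _ (top_smul_Z _ _ (PS0_topZ c)) (top_smul_Z _ _ (PS1_topZ c))) (top_smul_Z _ _ (shiftX_topZ _ (PS1_topZ c))) i j
  · exact top_add_Z _ _ (top_add_Z _ _ (top_smul_Z _ _ (PE0_topZ c)) (top_smul_Z _ _ (PE1_topZ c))) (top_smul_Z _ _ (shiftX_topZ _ (PE1_topZ c))) i j
  · rfl

/-- The `g_v,g₁,g₂` cell tables have empty top x-slice. [this work] -/
theorem cellTable_topX (d : Cert) (kind : ℕ) (hk : kind ≤ 2) (c : Fin 8) : ∀ j k : Fin 3, cellTable d kind c 2 j k = 0 := by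
  interval_cases kind
  · exact top_smul_X _ _ (TG_topX 0 c)
  · exact top_smul_X _ _ (TG_topX 1 c)
  · exact top_smul_X _ _ (TG_topX 2 c)

/-- Per-entry identity. -/
theorem eval_contrib (d : Cert) (e : Entry) (he : entryOk d e = true) (c c' : Fin 8) (p r₁ r₂ nS nE : ℝ) (hr : r₁ ≤ r₂)
    (hS : e.kind = 3 → nS * ((d.D : ℝ) * p) = d.SS + d.SS1 * p) (hE : e.kind = 4 → nE * ((d.D : ℝ) * p) = d.SE + d.SE1 * p) :
    eval (map (Int.castRingHom ℝ) (contrib d e c c')) p (1 - r₁) (1 - r₂) = condE d e p r₁ r₂ nS nE c c' := by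
  obtain ⟨hmono, hk5, hidx8, hmono2, hidx6, hsf, hef⟩ := entry_facts d e he
  unfold contrib condE
  by_cases hk4 : e.kind ≤ 4
  · rw [if_pos hk4, if_pos hk4]
    have hev : ∀ cc : Fin 8, eval (map (Int.castRingHom ℝ) (smul (e.mu : ℤ) (monoMul e.mono (cellTable d e.kind cc)))) p (1 - r₁) (1 - r₂) =
        (d.D : ℝ) * wt e p r₁ r₂ * GcoN p r₁ r₂ nS nE e.kind cc := by
      intro cc
      have hXc : e.mono % 2 = 1 → ∀ j k : Fin 3, cellTable d e.kind cc 2 j k = 0 := by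
        intro hm
        by_cases hk2 : e.kind ≤ 2
        · exact cellTable_topX d e.kind hk2 cc
        · exfalso
          have := hmono2 (by omega) hk4
          omega
      rw [BoxPoly.map_smul, eval_smul, eval_monoMul _ _ _ _ _ hXc (cellTable_topY d e.kind cc) (cellTable_topZ d e.kind cc),
        eval_cellTable d e.kind hk4 cc p r₁ r₂ nS nE hr hS hE]
      simp only [eq_intCast, Int.cast_natCast, wt]
      ring
    rw [BoxPoly.map_add, eval_add]
    congr 1
    · split_ifs with hc
      · exact hev c'
      · rw [BoxPoly.map_zero, eval_zero]
    · split_ifs with hc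
      · exact hev c
      · rw [BoxPoly.map_zero, eval_zero]
  · rw [if_neg hk4, if_neg hk4]
    by_cases h5 : e.kind = 5 ∧ e.idx < 6
    · rw [dif_pos h5, if_pos h5.1, BoxPoly.map_smul, eval_smul, eval_monoMul _ _ _ _ _ (fun _ => pone_topX) pone_topY pone_topZ, eval_pone]
      have hn : ¬ (e.kind = 3 ∨ e.kind = 4) := by omega
      have hH : (HrowN e.idx c c' : ℝ) = (Hrow ⟨e.idx, h5.2⟩ c c' : ℝ) := by
        obtain ⟨-, h6⟩ := h5
        unfold HrowN
        interval_cases hh : e.idx <;> simp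
      rw [hH]
      simp only [map_mul, eq_intCast, Int.cast_natCast, wt, sfac, hn, if_false]
      ring
    · have hk5' : ¬ e.kind = 5 := fun h => h5 ⟨h, hidx6 h⟩
      rw [dif_neg h5, if_neg hk5', BoxPoly.map_zero, eval_zero]

/-- Sum over the entries. -/
theorem eval_fold (d : Cert) (L : List Entry) (hL : ∀ e ∈ L, entryOk d e = true) (c c' : Fin 8) (p r₁ r₂ nS nE : ℝ) (hr : r₁ ≤ r₂)
    (hS : ∀ e ∈ L, e.kind = 3 → nS * ((d.D : ℝ) * p) = d.SS + d.SS1 * p) (hE : ∀ e ∈ L, e.kind = 4 → nE * ((d.D : ℝ) * p) = d.SE + d.SE1 * p) :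
    eval (map (Int.castRingHom ℝ) (L.foldr (fun e acc => add (contrib d e c c') acc) zero)) p (1 - r₁) (1 - r₂) =
      (L.map fun e => condE d e p r₁ r₂ nS nE c c').sum := by
  induction L with
  | nil => simp [BoxPoly.map_zero, eval_zero]
  | cons e L ih =>
    rw [List.foldr_cons, BoxPoly.map_add, eval_add, List.map_cons, List.sum_cons,
      eval_contrib d e (hL e (by simp)) c c' p r₁ r₂ nS nE hr (hS e (by simp)) (hE e (by simp)),
      ih (fun e' he' => hL e' (by simp [he'])) (fun e' he' => hS e' (by simp [he'])) (fun e' he' => hE e' (by simp [he']))]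

/-- Single-entry multipliers: `D · condU` of the weights of one entry is that entry's contribution. -/
theorem condU_single (d : Cert) (e : Entry) (he : entryOk d e = true) (p r₁ r₂ nS nE : ℝ) (c c' : Fin 8) :
    (d.D : ℝ) * condU p r₁ r₂ nS nE (fun i x => if e.kind = i.val ∧ e.idx = x.val then wt e p r₁ r₂ else 0)
        (fun k => if e.kind = 5 ∧ e.idx = k.val then wt e p r₁ r₂ else 0) c c' = condE d e p r₁ r₂ nS nE c c' := by
  obtain ⟨hmono, hk, hidx8, hmono2, hidx6, -, -⟩ := entry_facts d e he
  unfold condU condE GcoN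
  interval_cases hkv : e.kind
  · by_cases h1 : e.idx = c.val <;> by_cases h2 : e.idx = c'.val <;> by_cases h3 : c = c' <;> simp [h1, h2, h3, Fin.val_inj, @eq_comm _ c' c] <;> ring
  · by_cases h1 : e.idx = c.val <;> by_cases h2 : e.idx = c'.val <;> by_cases h3 : c = c' <;> simp [h1, h2, h3, Fin.val_inj, @eq_comm _ c' c] <;> ring
  · by_cases h1 : e.idx = c.val <;> by_cases h2 : e.idx = c'.val <;> by_cases h3 : c = c' <;> simp [h1, h2, h3, Fin.val_inj, @eq_comm _ c' c] <;> ring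
  · by_cases h1 : e.idx = c.val <;> by_cases h2 : e.idx = c'.val <;> by_cases h3 : c = c' <;> simp [h1, h2, h3, Fin.val_inj, @eq_comm _ c' c] <;> ring
  · by_cases h1 : e.idx = c.val <;> by_cases h2 : e.idx = c'.val <;> by_cases h3 : c = c' <;> simp [h1, h2, h3, Fin.val_inj, @eq_comm _ c' c] <;> ring
  · have h6 : e.idx < 6 := hidx6 rfl
    unfold HrowN
    interval_cases hiv : e.idx <;> simp <;> ring

/-- Linearity bookkeeping: the multipliers of a list are sums of single-entry multipliers, so `D · condU(lamL, nuL) = Σ condE`. -/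
theorem condU_lamL (d : Cert) (L : List Entry) (hL : ∀ e ∈ L, entryOk d e = true) (p r₁ r₂ nS nE : ℝ) (c c' : Fin 8) :
    (d.D : ℝ) * condU p r₁ r₂ nS nE (lamL L p r₁ r₂) (nuL L p r₁ r₂) c c' = (L.map fun e => condE d e p r₁ r₂ nS nE c c').sum := by
  induction L with
  | nil =>
    have e1 : lamL ([] : List Entry) p r₁ r₂ = fun _ _ => 0 := by funext i x; simp [lamL]
    have e2 : nuL ([] : List Entry) p r₁ r₂ = fun _ => 0 := by funext k; simp [nuL]
    rw [e1, e2, condU_zero]; simp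
  | cons e L ih =>
    have e1 : lamL (e :: L) p r₁ r₂ = fun i x => (if e.kind = i.val ∧ e.idx = x.val then wt e p r₁ r₂ else 0) + lamL L p r₁ r₂ i x := by
      funext i x; simp [lamL]
    have e2 : nuL (e :: L) p r₁ r₂ = fun k => (if e.kind = 5 ∧ e.idx = k.val then wt e p r₁ r₂ else 0) + nuL L p r₁ r₂ k := by
      funext k; simp [nuL]
    rw [e1, e2, condU_add, mul_add, condU_single d e (hL e (by simp)) p r₁ r₂ nS nE c c', ih (fun e' he' => hL e' (by simp [he'])),
      List.map_cons, List.sum_cons]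

/-- **Key identity.** -/
theorem eval_polyOf (d : Cert) (hL : ∀ e ∈ d.entries, entryOk d e = true) (c c' : Fin 8) (p r₁ r₂ nS nE : ℝ) (hr : r₁ ≤ r₂)
    (hS : ∀ e ∈ d.entries, e.kind = 3 → nS * ((d.D : ℝ) * p) = d.SS + d.SS1 * p) (hE : ∀ e ∈ d.entries, e.kind = 4 → nE * ((d.D : ℝ) * p) = d.SE + d.SE1 * p) :
    eval (map (Int.castRingHom ℝ) (polyOf d c c')) p (1 - r₁) (1 - r₂) =
      (d.D : ℝ) * condU p r₁ r₂ nS nE (lamL d.entries p r₁ r₂) (nuL d.entries p r₁ r₂) c c' := by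
  rw [polyOf, eval_fold d d.entries hL c c' p r₁ r₂ nS nE hr hS hE, condU_lamL d d.entries hL]

end BoxCert

end Quant

end Summit.CriticalPhenomena.PercolationContinuityZ3.Theorems
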